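import Mathlib
import Summits.CriticalPhenomena.PercolationContinuityZ3.Theorems.PercNearOneGluingNoHeavyLowerTailOrderedDifferencesIndependent

/-!
# The Marica–Schönheim PENCIL theorem: the weighted rows `[E ⊆ A] + t·[E ∩ A = ∅]` are independent for `t ≠ ±1`

Helper file for crux `stmt-CriticalPhenomena-4575` (`NoHeavyLowerTail`, route `PercNearOneGluingNoHeavy`),
new-inequality factory seat `prim-ineq-gen-3` (gen 20).  Everything here is PROVED; no definitions.

Gen 19's CONJECTURE `TYPE-t` (memo `run/shared/lean/prim/prim-ineq-gen-3/CONJECTURE-TYPET.md`) asks for the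
linear independence of the *weighted* incidence rows `u_A = (E ↦ [E ⊆ A] + t_A · [E ∩ A = ∅])` of a set family
over its word set, with one weight per TYPE; `t = 0` (all rows plain) is the Marica–Schönheim rank theorem
`OrderedDifferences.linearIndependent_incidence_diffs`.  This file proves the first genuinely weighted case,
the one-type pencil, and identifies the exceptional weights:

* `linearIndependent_pencil_diffs` — for every finite family `𝒜` of finite sets and every rational `t` with
  `t ≠ 1`, `t ≠ -1`, the rows `A ↦ (E ↦ [E ⊆ A] + t · [E ∩ A = ∅])`, `E ∈ 𝒜 \\ 𝒜`, are linearly independent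
  over `ℚ`.  Both exceptions are sharp: for two incomparable members the `2 × 2` minor on the columns
  `A \ B`, `B \ A` is `1 - t²`, and at `t = 1` (resp. `t = -1`) the two rows coincide (resp. are opposite) on
  `{∅, A \ B, B \ A}`.

**Proof (integrality of eigenvalues).**  Let `μ` be INTEGER Möbius weights of `T = 𝒜 \\ 𝒜`
(`exists_moebius_weights_int`: `∑_{E ∈ T, E ⊆ Z} μ E = [Z = ∅]` for `Z ∈ T`) and put
`κ Y = ∑_{E ∈ T, E ⊆ Y} μ E`.  Testing a dependency `∑_A c_A u_A = 0` against the integer vectors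
`E ↦ μ E · [E ∩ B = ∅]` and `E ↦ μ E · [E ⊆ B]` (`B ∈ 𝒜`) gives `c (L + t C) = 0` and `c (M + t Lᵀ) = 0` with the
INTEGER matrices `L A B = κ (A \ B) = [A ⊆ B]` (unitriangular, `det L = 1`), `M A B = κ (A ∩ B)` and
`C A B = ∑_{E ∈ T, E ∩ A = ∅, E ∩ B = ∅} μ E`.  Hence `c · (M L⁻ᵀ) = -t · c` and `c · (C L⁻¹) = -t⁻¹ · c`: both `-t`
and `-t⁻¹` are eigenvalues of integer matrices, i.e. algebraic integers (`exists_int_eq_of_vecMul_eq_smul`, via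
`Matrix.eval_charpoly` and the integral root theorem), so the rational `t` is a unit of `ℤ`, `t = ±1`.
(prim-ineq-gen-3 gen 20, 2026-08-23; memo `run/shared/lean/prim/prim-ineq-gen-3/THEOREM-MSPENCIL.md`.)
-/

namespace Summit.CriticalPhenomena.PercolationContinuityZ3.Theorems

namespace OrderedDifferences

open Finset Matrix Polynomial
open scoped FinsetFamily

variable {α : Type*} [DecidableEq α]

/-- **Integer Möbius weights.**  For a finite family `T` of finite sets there are integer weights `μ` with
`∑_{E ∈ T, E ⊆ Z} μ E = [Z = ∅]` for every `Z ∈ T` (same strong recursion as `exists_moebius_weights`). -/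
theorem exists_moebius_weights_int (T : Finset (Finset α)) :
    ∃ μ : Finset α → ℤ, ∀ Z ∈ T, ∑ E ∈ T.filter (· ⊆ Z), μ E = if Z = ∅ then 1 else 0 := by
  let H : (s : Finset α) → ((t : Finset α) → t ⊂ s → ℤ) → ℤ := fun s ih =>
    (if s = ∅ then (1 : ℤ) else 0) - ∑ t ∈ (T.filter (· ⊂ s)).attach, ih t.1 (mem_filter.mp t.2).2
  let μ : Finset α → ℤ := Finset.strongInduction H
  have hμ : ∀ s, μ s = (if s = ∅ then (1 : ℤ) else 0) - ∑ t ∈ T.filter (· ⊂ s), μ t := by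
    intro s
    have e : μ s = H s (fun t _ => μ t) := Finset.strongInduction_eq H s
    rw [e]
    show (if s = ∅ then (1 : ℤ) else 0) - ∑ t ∈ (T.filter (· ⊂ s)).attach, μ t.1 = _
    rw [sum_attach (T.filter (· ⊂ s)) (fun t => μ t)]
  refine ⟨μ, fun Z hZ => ?_⟩
  have hsplit : T.filter (· ⊆ Z) = insert Z (T.filter (· ⊂ Z)) := by
    ext E
    simp only [mem_filter, mem_insert]
    constructor
    · rintro ⟨hE, hEZ⟩
      rcases lt_or_eq_of_le hEZ with h | h
      · exact Or.inr ⟨hE, h⟩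
      · exact Or.inl h
    · rintro (rfl | ⟨hE, hEZ⟩)
      · exact ⟨hZ, subset_rfl⟩
      · exact ⟨hE, hEZ.le⟩
  have hnot : Z ∉ T.filter (· ⊂ Z) := by
    intro h
    exact lt_irrefl Z (mem_filter.mp h).2
  rw [hsplit, sum_insert hnot, hμ]
  abel

/-- **Rational eigenvalues of integer matrices are integers.**  If a non-zero rational row vector `c` satisfies
`c · N = s · c` for an integer matrix `N`, then `s ∈ ℤ` (the characteristic polynomial of `N` is monic with
integer coefficients and has `s` as a root; integral root theorem). -/
theorem exists_int_eq_of_vecMul_eq_smul {ι : Type*} [Fintype ι] [DecidableEq ι] (N : Matrix ι ι ℤ)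
    {c : ι → ℚ} (hc : c ≠ 0) {s : ℚ} (h : c ᵥ* N.map (Int.castRingHom ℚ) = s • c) :
    ∃ z : ℤ, (z : ℚ) = s := by
  set N' : Matrix ι ι ℚ := N.map (Int.castRingHom ℚ) with hN'
  have hsc : c ᵥ* Matrix.scalar ι s = s • c := by
    ext j
    simp [Matrix.scalar_apply, Matrix.vecMul_diagonal, mul_comm]
  have hker : c ᵥ* (Matrix.scalar ι s - N') = 0 := by
    rw [Matrix.vecMul_sub, h, hsc, sub_self]
  have hdet : (Matrix.scalar ι s - N').det = 0 :=
    (Matrix.exists_vecMul_eq_zero_iff).mp ⟨c, hc, hker⟩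
  have heval : N'.charpoly.eval s = 0 := by
    rw [Matrix.eval_charpoly]; exact hdet
  have hmap : N'.charpoly = N.charpoly.map (algebraMap ℤ ℚ) := by
    rw [hN']
    exact Matrix.charpoly_map N (Int.castRingHom ℚ)
  have haeval : aeval s N.charpoly = 0 := by
    rw [Polynomial.aeval_def, ← Polynomial.eval_map, ← hmap]; exact heval
  have hint : IsLocalization.IsInteger ℤ s := isInteger_of_is_root_of_monic (Matrix.charpoly_monic N) haeval
  obtain ⟨z, hz⟩ := RingHom.mem_rangeS.mp hint
  exact ⟨z, by simpa using hz⟩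

/-- The containment matrix `[A ⊆ B]` of a finite family of distinct finite sets has determinant `1`
(it is unitriangular for the order by cardinality). -/
theorem det_subsetMatrix_eq_one (𝒜 : Finset (Finset α)) :
    (Matrix.of fun (A B : 𝒜) => if (A : Finset α) ⊆ (B : Finset α) then (1 : ℤ) else 0).det = 1 := by
  classical
  let L : Matrix 𝒜 𝒜 ℤ := Matrix.of fun (A B : 𝒜) => if (A : Finset α) ⊆ (B : Finset α) then (1 : ℤ) else 0
  have hLap : ∀ A B : 𝒜, L A B = if (A : Finset α) ⊆ (B : Finset α) then (1 : ℤ) else 0 := fun A B => rfl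
  show L.det = 1
  -- block triangular with respect to the cardinality: `L A B = 0` when `#B < #A`
  have hBT : L.BlockTriangular (fun A : 𝒜 => #(A : Finset α)) := by
    intro A B hAB
    have hlt : #(B : Finset α) < #(A : Finset α) := hAB
    have hns : ¬ (A : Finset α) ⊆ (B : Finset α) := fun h => absurd (card_le_card h) (not_le.mpr hlt)
    rw [hLap, if_neg hns]
  rw [hBT.det]
  refine prod_eq_one fun k _ => ?_
  have hblock : L.toSquareBlock (fun A : 𝒜 => #(A : Finset α)) k = 1 := by
    ext ⟨A, hA⟩ ⟨B, hB⟩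
    rw [toSquareBlock_def, of_apply]
    by_cases h : A = B
    · subst h
      rw [one_apply_eq, hLap, if_pos subset_rfl]
    · have hcard : #(A : Finset α) = #(B : Finset α) := by
        have h1 : #(A : Finset α) = k := hA
        have h2 : #(B : Finset α) = k := hB
        exact h1.trans h2.symm
      have hns : ¬ (A : Finset α) ⊆ (B : Finset α) := fun hs =>
        h (Subtype.ext (eq_of_subset_of_card_le hs hcard.ge))
      rw [one_apply_ne (fun h' => h (Subtype.ext_iff.mp h')), hLap, if_neg hns]
  rw [hblock, det_one]

/-- **The Marica–Schönheim pencil theorem.**  For every finite family `𝒜` of finite sets and every rational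
`t ≠ ±1`, the weighted incidence rows `A ↦ (E ↦ [E ⊆ A] + t · [E ∩ A = ∅])` over the difference family
`𝒜 \\ 𝒜` are linearly independent over `ℚ`.  (`t = 0`: `linearIndependent_incidence_diffs`.) -/
theorem linearIndependent_pencil_diffs (𝒜 : Finset (Finset α)) {t : ℚ} (ht1 : t ≠ 1) (ht2 : t ≠ -1) :
    LinearIndependent ℚ (fun A : 𝒜 => fun E : (𝒜 \\ 𝒜 : Finset (Finset α)) =>
      (if (E : Finset α) ⊆ (A : Finset α) then (1 : ℚ) else 0) +
        t * (if Disjoint (E : Finset α) (A : Finset α) then (1 : ℚ) else 0)) := by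
  classical
  by_cases ht0 : t = 0
  · subst ht0
    simpa using linearIndependent_incidence_diffs 𝒜
  set T : Finset (Finset α) := 𝒜 \\ 𝒜 with hTdef
  -- every difference of two members is a word
  have hT : ∀ A ∈ 𝒜, ∀ B ∈ 𝒜, A \ B ∈ T := fun A hA B hB => mem_diffs.mpr ⟨A, hA, B, hB, rfl⟩
  obtain ⟨μ, hμ⟩ := exists_moebius_weights_int T
  -- the function κ and its value on differences of members
  let κ : Finset α → ℤ := fun Y => ∑ E ∈ T.filter (· ⊆ Y), μ E
  have hκ : ∀ A ∈ 𝒜, ∀ B ∈ 𝒜, κ (A \ B) = if A ⊆ B then 1 else 0 := by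
    intro A hA B hB
    show ∑ E ∈ T.filter (· ⊆ A \ B), μ E = _
    rw [hμ _ (hT A hA B hB)]
    simp [sdiff_eq_empty_iff_subset]
  -- the three integer matrices
  let L : Matrix 𝒜 𝒜 ℤ := Matrix.of fun A B => if (A : Finset α) ⊆ (B : Finset α) then (1 : ℤ) else 0
  let M : Matrix 𝒜 𝒜 ℤ := Matrix.of fun A B => κ ((A : Finset α) ∩ (B : Finset α))
  let C : Matrix 𝒜 𝒜 ℤ := Matrix.of fun A B =>
    ∑ E ∈ T.filter (fun E => Disjoint E (A : Finset α) ∧ Disjoint E (B : Finset α)), μ E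
  have hLap : ∀ A B : 𝒜, L A B = if (A : Finset α) ⊆ (B : Finset α) then (1 : ℤ) else 0 := fun A B => rfl
  have hMap : ∀ A B : 𝒜, M A B = κ ((A : Finset α) ∩ (B : Finset α)) := fun A B => rfl
  have hCap : ∀ A B : 𝒜, C A B =
      ∑ E ∈ T.filter (fun E => Disjoint E (A : Finset α) ∧ Disjoint E (B : Finset α)), μ E := fun A B => rfl
  let f : ℤ →+* ℚ := Int.castRingHom ℚ
  rw [Fintype.linearIndependent_iff]
  intro c hc
  by_contra hne
  have hc0 : c ≠ 0 := by
    intro h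
    apply hne
    intro i
    rw [h]; rfl
  -- pointwise form of the dependency
  have hdep : ∀ E : T, ∑ A : 𝒜, c A * ((if (E : Finset α) ⊆ (A : Finset α) then (1 : ℚ) else 0) +
      t * (if Disjoint (E : Finset α) (A : Finset α) then (1 : ℚ) else 0)) = 0 := by
    intro E
    have := congr_fun hc E
    simpa [Finset.sum_apply, Pi.smul_apply, smul_eq_mul] using this
  -- rewriting filtered sums over `T` as sums over the subtype `T`
  have hfilt : ∀ (p : Finset α → Prop) [DecidablePred p] (g : Finset α → ℚ),
      ∑ E ∈ T.filter p, g E = ∑ E : T, if p E then g E else 0 := by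
    intro p _ g
    rw [sum_filter, ← Finset.sum_coe_sort T]
  -- testing the dependency against an integer vector `w`
  have htest : ∀ w : Finset α → ℤ,
      ∑ A : 𝒜, c A * ((∑ E ∈ T.filter (· ⊆ (A : Finset α)), (μ E * w E : ℚ)) +
        t * ∑ E ∈ T.filter (fun E => Disjoint E (A : Finset α)), (μ E * w E : ℚ)) = 0 := by
    intro w
    have hA : ∀ A : 𝒜, (∑ E ∈ T.filter (· ⊆ (A : Finset α)), (μ E * w E : ℚ)) +
        t * ∑ E ∈ T.filter (fun E => Disjoint E (A : Finset α)), (μ E * w E : ℚ) =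
        ∑ E : T, (μ E * w E : ℚ) * ((if (E : Finset α) ⊆ (A : Finset α) then (1 : ℚ) else 0) +
          t * (if Disjoint (E : Finset α) (A : Finset α) then (1 : ℚ) else 0)) := by
      intro A
      rw [hfilt, hfilt, mul_sum, ← sum_add_distrib]
      refine sum_congr rfl fun E _ => ?_
      by_cases h1 : (E : Finset α) ⊆ (A : Finset α) <;>
        by_cases h2 : Disjoint (E : Finset α) (A : Finset α) <;> simp [h1, h2] <;> ring
    simp_rw [hA, mul_sum]
    rw [sum_comm]
    refine sum_eq_zero fun E _ => ?_
    have h3 : ∑ A : 𝒜, c A * ((μ E * w E : ℚ) * ((if (E : Finset α) ⊆ (A : Finset α) then (1 : ℚ) else 0) +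
        t * (if Disjoint (E : Finset α) (A : Finset α) then (1 : ℚ) else 0))) =
        (μ E * w E : ℚ) * ∑ A : 𝒜, c A * ((if (E : Finset α) ⊆ (A : Finset α) then (1 : ℚ) else 0) +
          t * (if Disjoint (E : Finset α) (A : Finset α) then (1 : ℚ) else 0)) := by
      rw [mul_sum]
      refine sum_congr rfl fun A _ => ?_
      ring
    rw [h3, hdep E, mul_zero]
  -- the four entry identities
  have eL : ∀ A B : 𝒜, ∑ E ∈ T.filter (· ⊆ (A : Finset α)),
      (μ E * (if Disjoint E (B : Finset α) then (1 : ℤ) else 0) : ℚ) = (L A B : ℚ) := by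
    intro A B
    rw [hLap, ← hκ _ A.2 _ B.2]
    show _ = ((∑ E ∈ T.filter (· ⊆ (A : Finset α) \ (B : Finset α)), μ E : ℤ) : ℚ)
    push_cast
    rw [sum_filter, sum_filter]
    refine sum_congr rfl fun E _ => ?_
    by_cases h1 : E ⊆ (A : Finset α) <;> by_cases h2 : Disjoint E (B : Finset α) <;>
      simp [h1, h2, subset_sdiff]
  have eC : ∀ A B : 𝒜, ∑ E ∈ T.filter (fun E => Disjoint E (A : Finset α)),
      (μ E * (if Disjoint E (B : Finset α) then (1 : ℤ) else 0) : ℚ) = (C A B : ℚ) := by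
    intro A B
    rw [hCap]
    push_cast
    rw [sum_filter, sum_filter]
    refine sum_congr rfl fun E _ => ?_
    by_cases h1 : Disjoint E (A : Finset α) <;> by_cases h2 : Disjoint E (B : Finset α) <;> simp [h1, h2]
  have eM : ∀ A B : 𝒜, ∑ E ∈ T.filter (· ⊆ (A : Finset α)),
      (μ E * (if E ⊆ (B : Finset α) then (1 : ℤ) else 0) : ℚ) = (M A B : ℚ) := by
    intro A B
    rw [hMap]
    show _ = ((∑ E ∈ T.filter (· ⊆ (A : Finset α) ∩ (B : Finset α)), μ E : ℤ) : ℚ)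
    push_cast
    rw [sum_filter, sum_filter]
    refine sum_congr rfl fun E _ => ?_
    by_cases h1 : E ⊆ (A : Finset α) <;> by_cases h2 : E ⊆ (B : Finset α) <;>
      simp [h1, h2, subset_inter_iff]
  have eLt : ∀ A B : 𝒜, ∑ E ∈ T.filter (fun E => Disjoint E (A : Finset α)),
      (μ E * (if E ⊆ (B : Finset α) then (1 : ℤ) else 0) : ℚ) = (L B A : ℚ) := by
    intro A B
    rw [hLap, ← hκ _ B.2 _ A.2]
    show _ = ((∑ E ∈ T.filter (· ⊆ (B : Finset α) \ (A : Finset α)), μ E : ℤ) : ℚ)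
    push_cast
    rw [sum_filter, sum_filter]
    refine sum_congr rfl fun E _ => ?_
    by_cases h1 : Disjoint E (A : Finset α) <;> by_cases h2 : E ⊆ (B : Finset α) <;>
      simp [h1, h2, subset_sdiff]
  -- (1) testing against `[E ∩ B = ∅]`:  c (L + t C) = 0
  have eq1 : ∀ B : 𝒜, ∑ A : 𝒜, c A * ((L A B : ℚ) + t * (C A B : ℚ)) = 0 := by
    intro B
    have h := htest (fun E => if Disjoint E (B : Finset α) then 1 else 0)
    rw [← h]
    refine sum_congr rfl fun A _ => ?_
    rw [eL A B, eC A B]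
  -- (2) testing against `[E ⊆ B]`:  c (M + t Lᵀ) = 0
  have eq2 : ∀ B : 𝒜, ∑ A : 𝒜, c A * ((M A B : ℚ) + t * (L B A : ℚ)) = 0 := by
    intro B
    have h := htest (fun E => if E ⊆ (B : Finset α) then 1 else 0)
    rw [← h]
    refine sum_congr rfl fun A _ => ?_
    rw [eM A B, eLt A B]
  -- matrix form over ℚ
  have eq1m : c ᵥ* L.map f = -t • (c ᵥ* C.map f) := by
    ext B
    have h := eq1 B
    simp only [Matrix.vecMul, dotProduct, Matrix.map_apply, Pi.smul_apply, smul_eq_mul, f,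
      eq_intCast] at h ⊢
    have h' : ∑ A, c A * (L A B : ℚ) + t * ∑ A, c A * (C A B : ℚ) = 0 := by
      rw [mul_sum, ← sum_add_distrib, ← h]
      refine sum_congr rfl fun A _ => ?_
      ring
    linear_combination h'
  have eq2m : c ᵥ* M.map f = -t • (c ᵥ* (L.transpose).map f) := by
    ext B
    have h := eq2 B
    simp only [Matrix.vecMul, dotProduct, Matrix.map_apply, Matrix.transpose_apply, Pi.smul_apply,
      smul_eq_mul, f, eq_intCast] at h ⊢
    have h' : ∑ A, c A * (M A B : ℚ) + t * ∑ A, c A * (L B A : ℚ) = 0 := by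
      rw [mul_sum, ← sum_add_distrib, ← h]
      refine sum_congr rfl fun A _ => ?_
      ring
    linear_combination h'
  -- `L` and `Lᵀ` are invertible over ℤ
  have hdetL : L.det = 1 := det_subsetMatrix_eq_one 𝒜
  have hUL : IsUnit L.det := by rw [hdetL]; exact isUnit_one
  have hULT : IsUnit L.transpose.det := by rw [det_transpose, hdetL]; exact isUnit_one
  -- (a)  c · (M L⁻ᵀ) = -t · c   ⇒  -t ∈ ℤ
  have ha : c ᵥ* (M * (L.transpose)⁻¹).map f = (-t) • c := by
    rw [Matrix.map_mul, ← Matrix.vecMul_vecMul, eq2m, Matrix.smul_vecMul, Matrix.vecMul_vecMul,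
      ← Matrix.map_mul, Matrix.mul_nonsing_inv _ hULT]
    simp
  obtain ⟨z₁, hz₁⟩ := exists_int_eq_of_vecMul_eq_smul (M * (L.transpose)⁻¹) hc0 ha
  -- (b)  c · (C L⁻¹) = -t⁻¹ · c  ⇒  -t⁻¹ ∈ ℤ
  have hb0 : c ᵥ* C.map f = (-t⁻¹) • (c ᵥ* L.map f) := by
    rw [eq1m, smul_smul]
    have : -t⁻¹ * -t = 1 := by field_simp
    rw [this, one_smul]
  have hb : c ᵥ* (C * L⁻¹).map f = (-t⁻¹) • c := by
    rw [Matrix.map_mul, ← Matrix.vecMul_vecMul, hb0, Matrix.smul_vecMul, Matrix.vecMul_vecMul,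
      ← Matrix.map_mul, Matrix.mul_nonsing_inv _ hUL]
    simp
  obtain ⟨z₂, hz₂⟩ := exists_int_eq_of_vecMul_eq_smul (C * L⁻¹) hc0 hb
  -- `z₁ z₂ = 1` in ℤ, so `z₁ = ±1`, i.e. `t = ∓1`
  have hprod : (z₁ * z₂ : ℤ) = 1 := by
    have : (z₁ : ℚ) * (z₂ : ℚ) = 1 := by rw [hz₁, hz₂]; field_simp
    exact_mod_cast this
  rcases Int.eq_one_or_neg_one_of_mul_eq_one hprod with h | h
  · apply ht2
    have : (-t : ℚ) = 1 := by rw [← hz₁, h]; simp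
    linear_combination -this
  · apply ht1
    have : (-t : ℚ) = -1 := by rw [← hz₁, h]; simp
    linear_combination -this

/-- **The abstract pencil lemma behind `linearIndependent_pencil_diffs`.**  If two integer matrices `Z, Y` with the
same row index both admit INTEGER right inverses (equivalently: both have full row rank modulo every prime), then
the rows of `Z + t · Y` are linearly independent over `ℚ` for every rational `t ≠ ±1`: a dependency `c (Z + t Y) = 0`
makes `-t` an eigenvalue of the integer matrix `Z · R_Y` and `-t⁻¹` an eigenvalue of `Y · R_Z`, so `t` and `t⁻¹` are
both integers.  (For a set family, `Z` = plain incidence rows and `Y` = complemented rows over `𝒜 \\ 𝒜` qualify by the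
unimodular Möbius pairing; for the three-family pencil of CONJECTURE `TYPE-t` the two ends are NOT of full rank in the
interesting instances — memo THEOREM-MSPENCIL.md §3 — which is why criterion `C0` remains the crux there.) -/
theorem linearIndependent_rows_add_smul_of_int_rightInverse {ι κ : Type*} [Fintype ι] [Fintype κ] [DecidableEq ι]
    (Z Y : Matrix ι κ ℤ) (RZ RY : Matrix κ ι ℤ) (hZ : Z * RZ = 1) (hY : Y * RY = 1)
    {t : ℚ} (ht1 : t ≠ 1) (ht2 : t ≠ -1) :
    LinearIndependent ℚ (fun i : ι => (Z.map (Int.castRingHom ℚ) + t • Y.map (Int.castRingHom ℚ)) i) := by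
  classical
  let f : ℤ →+* ℚ := Int.castRingHom ℚ
  rw [Fintype.linearIndependent_iff]
  intro c hc
  by_contra hne
  have hc0 : c ≠ 0 := by
    intro h
    apply hne
    intro i
    rw [h]; rfl
  -- the dependency in matrix form
  have hdep : c ᵥ* (Z.map f + t • Y.map f) = 0 := by
    rw [← hc]
    ext j
    simp [Matrix.vecMul, dotProduct, Finset.sum_apply, Pi.smul_apply, smul_eq_mul]
  have hZY : c ᵥ* Z.map f = -t • (c ᵥ* Y.map f) := by
    rw [Matrix.vecMul_add, Matrix.vecMul_smul] at hdep
    have := eq_neg_of_add_eq_zero_left hdep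
    rw [this, neg_smul]
  by_cases ht0 : t = 0
  · -- `t = 0`: `c Z = 0`, multiply by `R_Z`
    apply hc0
    have h1 : c ᵥ* Z.map f = 0 := by rw [hZY, ht0]; simp
    have h2 : c ᵥ* (Z * RZ).map f = c := by rw [hZ]; simp
    rw [Matrix.map_mul, ← Matrix.vecMul_vecMul, h1, Matrix.zero_vecMul] at h2
    exact h2.symm
  -- (a) `c · (Z R_Y) = -t · c`
  have ha : c ᵥ* (Z * RY).map f = (-t) • c := by
    rw [Matrix.map_mul, ← Matrix.vecMul_vecMul, hZY, Matrix.smul_vecMul, Matrix.vecMul_vecMul, ← Matrix.map_mul, hY]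
    simp
  obtain ⟨z₁, hz₁⟩ := exists_int_eq_of_vecMul_eq_smul (Z * RY) hc0 ha
  -- (b) `c · (Y R_Z) = -t⁻¹ · c`
  have hYZ : c ᵥ* Y.map f = (-t⁻¹) • (c ᵥ* Z.map f) := by
    rw [hZY, smul_smul]
    have : -t⁻¹ * -t = 1 := by field_simp
    rw [this, one_smul]
  have hb : c ᵥ* (Y * RZ).map f = (-t⁻¹) • c := by
    rw [Matrix.map_mul, ← Matrix.vecMul_vecMul, hYZ, Matrix.smul_vecMul, Matrix.vecMul_vecMul, ← Matrix.map_mul, hZ]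
    simp
  obtain ⟨z₂, hz₂⟩ := exists_int_eq_of_vecMul_eq_smul (Y * RZ) hc0 hb
  have hprod : (z₁ * z₂ : ℤ) = 1 := by
    have : (z₁ : ℚ) * (z₂ : ℚ) = 1 := by rw [hz₁, hz₂]; field_simp
    exact_mod_cast this
  rcases Int.eq_one_or_neg_one_of_mul_eq_one hprod with h | h
  · apply ht2
    have : (-t : ℚ) = 1 := by rw [← hz₁, h]; simp
    linear_combination -this
  · apply ht1
    have : (-t : ℚ) = -1 := by rw [← hz₁, h]; simp
    linear_combination -this

end OrderedDifferences

end Summit.CriticalPhenomena.PercolationContinuityZ3.Theorems
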